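import Mathlib
import Literature.Computability.Complexity.CNF
import Summits.PneNP.PneNP.Theorems.OverlapGapAlgebraSolvableImpliesStableSectionMeanSquareTransfer
import Summits.PneNP.PneNP.Theorems.OverlapGapAlgebraSearchHardWindowSequentialLocalPostProcRung

/-!
# PneNP / OverlapGapAlgebra — crux `SolvableImpliesStableSection` (stmt-PneNP-2463):
# the transfer HOLDS for post-processed sequential local solvers

Support for crux `stmt-PneNP-2463` (`Summit.PneNP.PneNP.Theses.OverlapGapAlgebra.SolvableImpliesStableSection`).
By `shwSeqP_meanSquare`, an index-order decimation rule with unit look-ahead `g₀` followed by any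
radius-`r` local post-processing `g` of `(Φ, g₀ Φ)` (decimation in a fixed order, then `r` rounds of
parallel local repair / message-passing re-estimation / bounded-range deterministic local search) is
ℓ²-stable at a polylogarithmic scale; hence the mean-square transfer applies at EVERY density:

* `sissSeqP_concl_of_postSolver` — for every `k ≥ 1`, `r`, `α, η, ν, ε > 0`: if infinitely often some
  such post-processed map solves an `ε`-fraction of `F_k(n, ⌊αn⌋)`, the conclusion of the crux holds
  for every `c > 0`;
* `sissSeqP_solvableImpliesStableSection_of_post` — the crux VERBATIM with `IsPolyTime f` REPLACED by
  "eventually in `n`, the decoded section of `f` is a radius-`r` local function of `(Φ, g₀ Φ)` for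
  some index-order decimation rule with unit look-ahead `g₀`" (no complexity hypothesis).
No definitions; axioms `propext`, `Classical.choice`, `Quot.sound`.
-/

set_option linter.dupNamespace false -- `Summit.PneNP.PneNP.…`: summit = sub-problem (D-0017)

namespace Summit.PneNP.PneNP.Theorems

open Finset Filter Asymptotics
open scoped Classical

/-- **Post-processed sequential local solvers give stable sections (every density).** -/
theorem sissSeqP_concl_of_postSolver (k r : ℕ) (hk : 1 ≤ k) (α η ν : ℝ) (hα : 0 < α)
    (hη : 0 < η) (hν : 0 < ν) (ε : ℝ) (hε : 0 < ε)
    (hsolv : ∃ᶠ n : ℕ in atTop, ∀ m : ℕ, m = ⌊α * n⌋₊ →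
      ∃ g₀ g : (Fin m → Fin k → Fin n × Bool) → (Fin n → Bool), (∀ (Φ Φ' : (Fin m → Fin k → Fin n × Bool)) (v : Fin n),
        (∀ i : Fin m, ((∃ j : Fin k, (Φ i j).1 = v) ∨ (∃ j : Fin k, (Φ' i j).1 = v)) → Φ i = Φ' i) →
        (∀ (i : Fin m) (j j' : Fin k), (Φ i j).1 = v → (Φ i j').1 < v →
          g₀ Φ (Φ i j').1 = g₀ Φ' (Φ i j').1) →
        g₀ Φ v = g₀ Φ' v) ∧ (∀ (Φ Φ' : (Fin m → Fin k → Fin n × Bool)) (v : Fin n),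
        (∀ i : Fin m, ((∃ j : Fin k, ∃ pw : ℕ → Fin n, pw 0 = v ∧ pw r = (Φ i j).1 ∧
          (∀ s, s < r → (pw s = pw (s + 1) ∨
            ∃ i' : Fin m, ∃ j₁ j₂ : Fin k, (Φ i' j₁).1 = pw s ∧ (Φ i' j₂).1 = pw (s + 1)))) ∨
         (∃ j : Fin k, ∃ pw : ℕ → Fin n, pw 0 = v ∧ pw r = (Φ' i j).1 ∧
          (∀ s, s < r → (pw s = pw (s + 1) ∨
            ∃ i' : Fin m, ∃ j₁ j₂ : Fin k, (Φ' i' j₁).1 = pw s ∧ (Φ' i' j₂).1 = pw (s + 1))))) → Φ i = Φ' i) →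
        (∀ u : Fin n, (∃ pw : ℕ → Fin n, pw 0 = v ∧ pw r = u ∧
          (∀ s, s < r → (pw s = pw (s + 1) ∨
            ∃ i' : Fin m, ∃ j₁ j₂ : Fin k, (Φ i' j₁).1 = pw s ∧ (Φ i' j₂).1 = pw (s + 1)))) → g₀ Φ u = g₀ Φ' u) →
        g Φ v = g Φ' v) ∧
        ε * Fintype.card (Fin m → Fin k → Fin n × Bool) ≤
          ((Finset.univ.filter fun Φ : Fin m → Fin k → Fin n × Bool =>
            ∀ i, ∃ j, g Φ (Φ i j).1 = (Φ i j).2).card : ℝ))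
    (c : ℝ) (hc : 0 < c) :
    ∃ᶠ n : ℕ in atTop, ∀ m : ℕ, m = ⌊α * n⌋₊ →
      ∃ g : (Fin m → Fin k → Fin n × Bool) → (Fin n → Bool),
        Real.exp (-(c * n)) * Fintype.card (Fin (k + 1) → Fin m → Fin k → Fin n × Bool) ≤
        ((Finset.univ.filter fun Ψ : Fin (k + 1) → Fin m → Fin k → Fin n × Bool =>
          let P : Fin k → ℕ → Fin m → Fin k → Fin n × Bool :=
            fun r q a b => if (a : ℕ) * k + b < q then Ψ r.succ a b else Ψ r.castSucc a b
          (∀ r : Fin k, ∀ q ≤ m * k, ((Finset.univ.filter fun i : Fin m =>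
            ∀ j, g (P r q) (P r q i j).1 ≠ (P r q i j).2).card : ℝ) ≤ ν * m) ∧
          ∀ r : Fin k, ∀ q < m * k,
            (hammingDist (g (P r q)) (g (P r (q + 1))) : ℝ) ≤ η * n).card : ℝ) := by
  set Kx : ℝ := (1 + α * (k : ℝ) ^ 2) * Real.exp (α * (k : ℝ) ^ 2 * (1 + (k : ℝ) ^ 2 + α * (k : ℝ) ^ 2))
    with hKx
  have hKx0 : 0 ≤ Kx := by rw [hKx]; positivity
  refine sissMS_concl_of_meanSquareStableSolver k hk α η ν hα hη hν
    (fun n : ℕ => 8 * (k : ℝ) ^ 2 * (3 * k * Real.log n + k + 1) ^ (2 * r) +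
      2 * ((k : ℝ) + 1) ^ 2 * (3 * k * Real.log n + k + 1) ^ (2 * r) * Kx + 1)
    (shwSeqP_isLittleO k r Kx hKx0) ε hε ?_ c hc
  have hlargeE : ∀ᶠ n : ℕ in atTop, Real.exp (α * k * Real.exp 2) ≤ (n : ℝ) ^ 3 :=
    ((tendsto_pow_atTop (by norm_num : (3 : ℕ) ≠ 0)).comp tendsto_natCast_atTop_atTop).eventually_ge_atTop _
  refine (hsolv.and_eventually (hlargeE.and (eventually_ge_atTop 1))).mono ?_
  rintro n ⟨hn, hlarge, hn1⟩ m hm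
  obtain ⟨g₀, g, hseq, hpost, hsucc⟩ := hn m hm
  have hm_le : (m : ℝ) ≤ α * n := by rw [hm]; exact Nat.floor_le (by positivity)
  exact ⟨g, shwSeqP_meanSquare r hn1 α hα.le hm_le hlarge g₀ g hseq hpost, hsucc⟩

/-- **`SolvableImpliesStableSection` HOLDS on the class of post-processed sequential local solvers.**
The crux verbatim, with `IsPolyTime f` REPLACED by "eventually in `n`, the decoded section of `f` on
`F_k(n, ⌊αn⌋₊)` is a radius-`r` local function of `(Φ, g₀ Φ)` for some index-order decimation rule
with unit look-ahead `g₀`" (no complexity hypothesis, every density). -/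
theorem sissSeqP_solvableImpliesStableSection_of_post (k r : ℕ) (hk : 1 ≤ k) (α η ν : ℝ)
    (hα : 0 < α) (hη : 0 < η) (hν : 0 < ν)
    (hsolv : ∃ f : List Bool → List Bool,
      (∀ᶠ n : ℕ in atTop, ∀ m : ℕ, m = ⌊α * n⌋₊ →
        ∃ g₀ : (Fin m → Fin k → Fin n × Bool) → (Fin n → Bool), (∀ (Φ Φ' : (Fin m → Fin k → Fin n × Bool)) (v : Fin n),
        (∀ i : Fin m, ((∃ j : Fin k, (Φ i j).1 = v) ∨ (∃ j : Fin k, (Φ' i j).1 = v)) → Φ i = Φ' i) →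
        (∀ (i : Fin m) (j j' : Fin k), (Φ i j).1 = v → (Φ i j').1 < v →
          g₀ Φ (Φ i j').1 = g₀ Φ' (Φ i j').1) →
        g₀ Φ v = g₀ Φ' v) ∧ (∀ (Φ Φ' : (Fin m → Fin k → Fin n × Bool)) (v : Fin n),
        (∀ i : Fin m, ((∃ j : Fin k, ∃ pw : ℕ → Fin n, pw 0 = v ∧ pw r = (Φ i j).1 ∧
          (∀ s, s < r → (pw s = pw (s + 1) ∨
            ∃ i' : Fin m, ∃ j₁ j₂ : Fin k, (Φ i' j₁).1 = pw s ∧ (Φ i' j₂).1 = pw (s + 1)))) ∨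
         (∃ j : Fin k, ∃ pw : ℕ → Fin n, pw 0 = v ∧ pw r = (Φ' i j).1 ∧
          (∀ s, s < r → (pw s = pw (s + 1) ∨
            ∃ i' : Fin m, ∃ j₁ j₂ : Fin k, (Φ' i' j₁).1 = pw s ∧ (Φ' i' j₂).1 = pw (s + 1))))) → Φ i = Φ' i) →
        (∀ u : Fin n, (∃ pw : ℕ → Fin n, pw 0 = v ∧ pw r = u ∧
          (∀ s, s < r → (pw s = pw (s + 1) ∨
            ∃ i' : Fin m, ∃ j₁ j₂ : Fin k, (Φ i' j₁).1 = pw s ∧ (Φ i' j₂).1 = pw (s + 1)))) → g₀ Φ u = g₀ Φ' u) →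
        (f (Literature.Computability.Complexity.encodingCNF.encode (List.ofFn fun a =>
            List.ofFn fun b => (((Φ a b).1 : ℕ), (Φ a b).2)))).getD v false =
        (f (Literature.Computability.Complexity.encodingCNF.encode (List.ofFn fun a =>
            List.ofFn fun b => (((Φ' a b).1 : ℕ), (Φ' a b).2)))).getD v false)) ∧
      ∃ ε : ℝ, 0 < ε ∧ ∃ᶠ n : ℕ in Filter.atTop, ∀ m : ℕ, m = ⌊α * n⌋₊ → ε ≤
        ((Finset.univ.filter fun Φ : Fin m → Fin k → Fin n × Bool => ∀ i, ∃ j,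
          (f (Literature.Computability.Complexity.encodingCNF.encode (List.ofFn fun a =>
            List.ofFn fun b => (((Φ a b).1 : ℕ), (Φ a b).2)))).getD (Φ i j).1 false = (Φ i j).2).card : ℝ) / Fintype.card (Fin m → Fin k → Fin n × Bool))
    (c : ℝ) (hc : 0 < c) :
    ∃ᶠ n : ℕ in Filter.atTop, ∀ m : ℕ, m = ⌊α * n⌋₊ →
      ∃ g : (Fin m → Fin k → Fin n × Bool) → (Fin n → Bool),
        Real.exp (-(c * n)) * Fintype.card (Fin (k + 1) → Fin m → Fin k → Fin n × Bool) ≤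
        ((Finset.univ.filter fun Ψ : Fin (k + 1) → Fin m → Fin k → Fin n × Bool =>
          let P : Fin k → ℕ → Fin m → Fin k → Fin n × Bool :=
            fun r q a b => if (a : ℕ) * k + b < q then Ψ r.succ a b else Ψ r.castSucc a b
          (∀ r : Fin k, ∀ q ≤ m * k, ((Finset.univ.filter fun i : Fin m =>
            ∀ j, g (P r q) (P r q i j).1 ≠ (P r q i j).2).card : ℝ) ≤ ν * m) ∧
          ∀ r : Fin k, ∀ q < m * k,
            (hammingDist (g (P r q)) (g (P r (q + 1))) : ℝ) ≤ η * n).card : ℝ) := by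
  obtain ⟨f, hPOST, ε, hε, hfreq⟩ := hsolv
  refine sissSeqP_concl_of_postSolver k r hk α η ν hα hη hν ε hε ?_ c hc
  refine (hfreq.and_eventually (hPOST.and (eventually_ge_atTop 1))).mono ?_
  rintro n ⟨hn, hPn, hn1⟩ m hm
  obtain ⟨g₀, hseq, hpost⟩ := hPn m hm
  refine ⟨g₀, fun Φ v => (f (Literature.Computability.Complexity.encodingCNF.encode (List.ofFn fun a =>
            List.ofFn fun b => (((Φ a b).1 : ℕ), (Φ a b).2)))).getD v false, hseq, hpost, ?_⟩
  have h := hn m hm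
  haveI : Nonempty (Fin n × Bool) := ⟨(⟨0, hn1⟩, false)⟩
  have hN : (0 : ℝ) < Fintype.card (Fin m → Fin k → Fin n × Bool) := by
    exact_mod_cast Fintype.card_pos
  rw [le_div_iff₀ hN] at h
  exact h

end Summit.PneNP.PneNP.Theorems
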